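import Mathlib
import HarnessLib
import Summits.NavierStokesRegularity.NavierStokesRegularity.Theorems.PoloidalWindowDoorLrcModEntireFarThreadReduction

/-!
# Route `PoloidalWindowDoor`, crux `PoloidalWindowRigidity` (stmt-19708) — THE FAR-THREAD REDUCTION FOR THE CRUX, FROM THE REGISTERED v5 STUBS

Seat ns-poloidal-K2-p2 g10 (LEAD-lineage on 19708; file `--supports`).  Companion of LEAD K2-p3's `…LrcModEntireFarThreadReduction` (p633507): there the
item `LrcModEntire` (20428) is derived from the REGISTERED v5 stubs {`stub_localTHEmptyHypNUGRS`, `stub_threadedThickEmpty`} and the crux 19708 from the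
(TH)∩twisting GERM form of S0; here the crux 19708 is derived from the REGISTERED (NUGRS) form too — `poloidalWindowRigidity_of_NUGRS_of_threadedThick` —
so that both items close by one application from the same two statements (and a 19708 registry mirror of v5 is a formality).

WHAT THIS IS NOT: not a claim about Navier–Stokes regularity; a conditional reduction (bears_on LADDER-NS N0 via crux 19708). [folklore]
-/

noncomputable section

-- the summit and its single sub-problem share the name (CONVENTIONS §1), as in every Theorems file
set_option linter.dupNamespace false

namespace Summit.NavierStokesRegularity.NavierStokesRegularity.Theorems.PoloidalWindowDoorPoloidalWindowRigidityFarThreadReductionNUGRS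

open MeasureTheory Set Function Filter Topology Metric
open scoped RealInnerProductSpace InnerProductSpace Laplacian
open Literature.Analysis Literature.Analysis.FluidPDE
open Summit.NavierStokesRegularity.NavierStokesRegularity.Theses.PoloidalWindowDoor
open Summit.NavierStokesRegularity.NavierStokesRegularity.Theorems.LocalSineTubeDoorProfileAlignedWindowRigidityAncient
open Summit.NavierStokesRegularity.NavierStokesRegularity.Theorems.PoloidalWindowDoorLrcModEntireThreadPins
open Summit.NavierStokesRegularity.NavierStokesRegularity.Theorems.PoloidalWindowDoorPoloidalWindowRigiditySharper
open Summit.NavierStokesRegularity.NavierStokesRegularity.Theorems.PoloidalWindowDoorPoloidalWindowRigidityFlat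
open Summit.NavierStokesRegularity.NavierStokesRegularity.Theorems.PoloidalWindowDoorLrcModEntireIff
open Summit.NavierStokesRegularity.NavierStokesRegularity.Theorems.PoloidalWindowDoorLrcModEntireUntwistedGerm
open Summit.NavierStokesRegularity.NavierStokesRegularity.Theorems.PoloidalWindowDoorLrcModEntireTwistingTHLocalHypGerm
open Summit.NavierStokesRegularity.NavierStokesRegularity.Theorems.PoloidalWindowDoorLrcModEntireTwistingTHLocalNonUmbilic
open Summit.NavierStokesRegularity.NavierStokesRegularity.Theorems.PoloidalWindowDoorLrcModEntireTwistingTHLocalGalilean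
open Summit.NavierStokesRegularity.NavierStokesRegularity.Theorems.PoloidalWindowDoorLrcModEntireTwistingTHLocalNormalFormRS
open Summit.NavierStokesRegularity.NavierStokesRegularity.Theorems.PoloidalWindowDoorPoloidalWindowRigidityTimeShearPressure
open Summit.NavierStokesRegularity.NavierStokesRegularity.Theorems.PoloidalWindowDoorPoloidalWindowRigidityTimeShearLiminf
open Summit.NavierStokesRegularity.NavierStokesRegularity.Theorems.PoloidalWindowDoorPoloidalWindowRigidityHorizontalFlatPast
open Summit.NavierStokesRegularity.NavierStokesRegularity.Theorems.PoloidalWindowDoorPoloidalWindowRigiditySymmetryGerms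
open Summit.NavierStokesRegularity.NavierStokesRegularity.Theorems.PoloidalWindowDoorPoloidalWindowRigidityVerticalShearGerm
open Summit.NavierStokesRegularity.NavierStokesRegularity.Theorems.LocalSineTubeDoorProfileAlignedWindowRigidityAncient
open Summit.NavierStokesRegularity.NavierStokesRegularity.Theorems.PoloidalWindowDoorLrcModEntireFarThreadReduction

/-- **The CRUX `PoloidalWindowRigidity` (stmt-19708) BY NAME from the REGISTERED v5 stubs of item 20428** — the registered local (TH) statement
`stub_localTHEmptyHypNUGRS` (VERBATIM, `hS0`) and the threaded-thick emptiness `stub_threadedThickEmpty` (VERBATIM, `hS3`): the 19708 twin of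
`…FarThreadReduction.lrcModEntire_of_NUGRS_of_threadedThick` (same tree chain `…NormalFormRS` → `…Galilean` → `…NonUmbilic` → `…HypGerm` for the germ
statement, then `poloidalWindowRigidity_of_TH_of_threadedThick`).  The day v5's two stubs land, the crux closes by ONE application of this theorem. [folklore] -/
theorem poloidalWindowRigidity_of_NUGRS_of_threadedThick
    (hS0 : ∀ (u : ℝ → EuclideanSpace ℝ (Fin 3) → EuclideanSpace ℝ (Fin 3)) (μ A : ℝ → ℝ → ℝ)
        (U : Set (ℝ × EuclideanSpace ℝ (Fin 3))) (p₀ : ℝ × EuclideanSpace ℝ (Fin 3)),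
        IsOpen U → p₀ ∈ U →
        AnalyticOnNhd ℝ (Function.uncurry u) U →
        (∀ p ∈ U, AnalyticAt ℝ (Function.uncurry μ) (p.1, p.2 2)) →
        (∀ p ∈ U, AnalyticAt ℝ (Function.uncurry A) (p.1, p.2 2)) →
        (∀ p ∈ U, fderiv ℝ (u p.1) p.2 (EuclideanSpace.single 0 1) 1 = fderiv ℝ (u p.1) p.2 (EuclideanSpace.single 1 1) 0) →
        (∀ p ∈ U, fderiv ℝ (u p.1) p.2 (EuclideanSpace.single 0 1) 0 + fderiv ℝ (u p.1) p.2 (EuclideanSpace.single 1 1) 1 +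
          fderiv ℝ (u p.1) p.2 (EuclideanSpace.single 2 1) 2 = 0) →
        (∀ p ∈ U, ∀ b : Fin 3, b ≠ 2 →
          fderiv ℝ (u p.1) p.2 (EuclideanSpace.single 2 1) b =
            μ p.1 (p.2 2) * fderiv ℝ (u p.1) p.2 (EuclideanSpace.single b 1) 2) →
        (∀ p ∈ U,
          (1 - μ p.1 (p.2 2)) *
              (deriv (fun s => u s p.2 2) p.1 + fderiv ℝ (fun y => u p.1 y 2) p.2 (u p.1 p.2)
                - Δ (fun y => u p.1 y 2) p.2) =
            A p.1 (p.2 2) + (deriv (fun s => μ s (p.2 2)) p.1 - deriv (deriv (μ p.1)) (p.2 2)) * u p.1 p.2 2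
              + deriv (μ p.1) (p.2 2) / 2 * u p.1 p.2 2 ^ 2
              - 2 * deriv (μ p.1) (p.2 2) * fderiv ℝ (u p.1) p.2 (EuclideanSpace.single 2 1) 2) →
        fderiv ℝ (fun y => fderiv ℝ (u p₀.1) y (EuclideanSpace.single 2 1) 2) p₀.2 (EuclideanSpace.single 0 1) *
              fderiv ℝ (u p₀.1) p₀.2 (EuclideanSpace.single 1 1) 2 -
            fderiv ℝ (fun y => fderiv ℝ (u p₀.1) y (EuclideanSpace.single 2 1) 2) p₀.2 (EuclideanSpace.single 1 1) *
              fderiv ℝ (u p₀.1) p₀.2 (EuclideanSpace.single 0 1) 2 ≠ 0 →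
        μ p₀.1 (p₀.2 2) ≠ 0 → μ p₀.1 (p₀.2 2) ≠ 1 → deriv (μ p₀.1) (p₀.2 2) ≠ 0 →
        μ p₀.1 (p₀.2 2) < 0 →
        (fderiv ℝ (u p₀.1) p₀.2 (EuclideanSpace.single 0 1) 0 ≠ fderiv ℝ (u p₀.1) p₀.2 (EuclideanSpace.single 1 1) 1 ∨
          fderiv ℝ (u p₀.1) p₀.2 (EuclideanSpace.single 1 1) 0 ≠ 0) →
        u p₀.1 p₀.2 = 0 → 
        fderiv ℝ (u p₀.1) p₀.2 (EuclideanSpace.single 0 1) 2 = 0 →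
        fderiv ℝ (u p₀.1) p₀.2 (EuclideanSpace.single 1 1) 2 = 1 → False)
    (hS3 : ∀ (C : ℝ) (v : ℝ → EuclideanSpace ℝ (Fin 3) → EuclideanSpace ℝ (Fin 3)),
        Literature.Analysis.FluidPDE.HasTypeITimeDecay C v →
        ContinuousOn (Function.uncurry v) (Set.Iio (0 : ℝ) ×ˢ Set.univ) →
        (∀ s t : ℝ, s < t → t < 0 → ∀ x, v t x =
          Literature.Analysis.UnboundedOperators.heatExtension (v s) (t - s) x -
            Literature.Analysis.FluidPDE.oseenDuhamel 1 s v v t x) →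
        (∀ t < 0, Literature.Analysis.FluidPDE.VectorCalculus.IsDivFree (v t)) →
        (∀ s < 0, ∀ y, ⟪Literature.Analysis.FluidPDE.curl (v s) y, EuclideanSpace.single 2 1⟫_ℝ = 0) →
        v (-1) 0 2 ≠ 0 → (∀ t < 0, ∀ x, Real.sqrt (-t) * |v t x 2| ≤ |v (-1) 0 2|) →
        (∀ h : EuclideanSpace ℝ (Fin 3), fderiv ℝ (v (-1)) 0 h 2 = 0) →
        (deriv (fun s => v s 0 2) (-1) = v (-1) 0 2 / 2 ∧ v (-1) 0 2 * (Δ (fun y => v (-1) y 2)) 0 ≤ 0) →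
        ∀ W : Set (ℝ × EuclideanSpace ℝ (Fin 3)), IsOpen W → W ⊆ Set.Iio (0 : ℝ) ×ˢ Set.univ →
          (∀ z ∈ W, (Literature.Analysis.FluidPDE.curl (v z.1) z.2 ≠ 0 ∧
              (fderiv ℝ (v z.1) z.2 (EuclideanSpace.single 0 1) 2 ≠ 0 ∨ fderiv ℝ (v z.1) z.2 (EuclideanSpace.single 1 1) 2 ≠ 0) ∧
              (fderiv ℝ (v z.1) z.2 (EuclideanSpace.single 2 1) 0 ≠ 0 ∨ fderiv ℝ (v z.1) z.2 (EuclideanSpace.single 2 1) 1 ≠ 0)) ∧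
            (fderiv ℝ (fun x => fderiv ℝ (v z.1) x (EuclideanSpace.single 2 1) 2) z.2 (EuclideanSpace.single 0 1) *
                  fderiv ℝ (v z.1) z.2 (EuclideanSpace.single 1 1) 2 -
                fderiv ℝ (fun x => fderiv ℝ (v z.1) x (EuclideanSpace.single 2 1) 2) z.2 (EuclideanSpace.single 1 1) *
                  fderiv ℝ (v z.1) z.2 (EuclideanSpace.single 0 1) 2 ≠ 0)) →
          (∀ m : ℝ → ℝ → ℝ, ∀ W₁ : Set (ℝ × EuclideanSpace ℝ (Fin 3)), W₁ ⊆ W → IsOpen W₁ → W₁.Nonempty →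
              ∃ z ∈ W₁, ∃ b : Fin 3, b ≠ 2 ∧
                fderiv ℝ (v z.1) z.2 (EuclideanSpace.single 2 1) b ≠
                  m z.1 (z.2 2) * fderiv ℝ (v z.1) z.2 (EuclideanSpace.single b 1) 2) →
          (∀ r : ℝ, 0 < r → (Metric.ball ((-1 : ℝ), (0 : EuclideanSpace ℝ (Fin 3))) r ∩ W).Nonempty) →
          False) :
    Summit.NavierStokesRegularity.NavierStokesRegularity.Theses.PoloidalWindowDoor.PoloidalWindowRigidity :=
  poloidalWindowRigidity_of_TH_of_threadedThick
    (stub_twistingTH_of_localEmptyHyp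
      (localTHEmptyHyp_of_localTHEmptyHypNonUmbilic (localTHEmptyHypNonUmbilic_of_galilean (localTHEmptyHypNF_of_normalFormRS hS0))))
    hS3


end Summit.NavierStokesRegularity.NavierStokesRegularity.Theorems.PoloidalWindowDoorPoloidalWindowRigidityFarThreadReductionNUGRS

end
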